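import Summits.NavierStokesRegularity.NavierStokesRegularity.Theorems.TypeICertificateLadderNoTypeIBlowupTypeIMorrey
import Literature.Analysis.FluidPDE.NSCriticalClosureBesovKatoClass
import Literature.Analysis.FluidPDE.NSCriticalClosureBesovBounded
import Literature.Analysis.FluidPDE.NSLerayOseenRepresentation
import Literature.Analysis.FluidPDE.NSBoundedMildOseenRestart
import Literature.Analysis.FluidPDE.NSBoundedMildSmoothing
import Literature.Analysis.FluidPDE.KNSSTypeIRateMildBridge
import Literature.Analysis.FluidPDE.KNSSTypeIRateMildProofs
import Literature.Analysis.UnboundedOperators.HeatKernelBoundedData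
import HarnessLib

/-!
# The Type-I zoom sequence of a classical solution at a final-time point
# (route `SqueezeCycle`, item `SingularZoom`, stmt-NavierStokesRegularity-10573), I: global data

Helper file (theorems only). For `ν > 0`, `T > 0` and a classical solution `(u, p)` of
Navier–Stokes on `ℝ³ × [0, T)`, Leray–Hopf from its rapidly decaying datum:

* `oseen_eq_of_classical` — the **Oseen integral equation between positive times**,
  `u(t) = e^{ν(t-s)Δ}u(s) - B^ν_s(u,u)(t)` pointwise for `0 < s < t < T` (Lemarié-Rieusset 2016,
  Thm. 6.1 / Fabes–Jones–Rivière 1972: the tree's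
  `ae_eq_heatExtension_sub_oseenDuhamel_of_isMildNSSolutionOn` for the bounded finite-energy
  duality-mild field `u` (bounded on closed sub-strips by `exists_forall_norm_le_of_tao2011`),
  restarted at `s` by `oseenMild_restart_holds`, and upgraded from a.e. to everywhere by
  continuity of both sides);
* `oseen_eq_timeRescale_of_classical` — the same at unit viscosity for the normalised field
  `ũ(s, x) = ν⁻¹u(s/ν, x)` on `(0, νT)`;
* `typeIZoomSeq` facts — for the viscosity-normalising parabolic zooms
  `w_c = (cα) • u ∘ Φ_c`, `Φ_c(s, y) = (T + c²β s, x₀ + cR y)` (`α = R/ν`, `β = R²/ν`) about a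
  final-time point `(T, x₀)`: they are classical unit-viscosity solutions on the final windows
  `(-δ/(c²β), 0)`, jointly continuous with weakly divergence-free slices, satisfy the Oseen
  equation there (`oseen_smul_stPull`), and obey the common Type-I bound
  `‖w_c(s, y)‖ ≤ (αC/√β)/√(-s)` inherited from the rate `√(T-t)‖u(t,x)‖ ≤ C` on `(T-δ, T)`.
-/

noncomputable section

open MeasureTheory Set Function Filter TopologicalSpace Metric
open scoped Topology NNReal ENNReal InnerProductSpace RealInnerProductSpace

namespace Summit.NavierStokesRegularity.NavierStokesRegularity.Theorems

open Literature.Analysis Literature.Analysis.FluidPDE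

section Oseen

variable {ν T : ℝ} {u : ℝ → EuclideanSpace ℝ (Fin 3) → EuclideanSpace ℝ (Fin 3)}
  {p : ℝ → EuclideanSpace ℝ (Fin 3) → ℝ}

/-- **The Oseen integral equation of a classical Leray–Hopf solution between positive times**:
for `ν > 0`, `0 < T`, a classical solution on `ℝ³ × [0, T)`, Leray–Hopf from its rapidly decaying
datum, and `0 < s < t < T`, `u(t) = e^{ν(t−s)Δ}u(s) − B^ν_s(u, u)(t)` pointwise
(Lemarié-Rieusset 2016, Thm. 6.1 with Prop. 6.5; Fabes–Jones–Rivière 1972, Thm. 2.1; KNSS 2009,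
§4 p. 8 for the restart). [cite: LemarieRieusset2016, Thm. 6.1 with Prop. 6.5 (pp. 133–136)] -/
theorem oseen_eq_of_classical (hν : 0 < ν) (hT : 0 < T)
    (hsol : IsClassicalNSSolutionOn (Ico 0 T) ν 0 u p) (hLH : IsLerayHopfOn T ν 0 (u 0) u)
    (h₀ : HasRapidSpatialDecay (u 0)) {s t : ℝ} (hs : 0 < s) (hst : s < t) (htT : t < T)
    (x : EuclideanSpace ℝ (Fin 3)) :
    u t x = UnboundedOperators.heatExtension (u s) (ν * (t - s)) x - oseenDuhamel ν s u u t x := by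
  -- boundedness on closed sub-strips
  have hbdd := exists_forall_norm_le_of_tao2011 tao2011_hasBoundedSobolevNormsOn_holds hν hsol hLH h₀
  have hcont : ContinuousOn (uncurry u) (Ico 0 T ×ˢ univ) := hsol.smooth_velocity.continuousOn
  have hmeasT : AEStronglyMeasurable (uncurry u) (volume.restrict (Ioo 0 T ×ˢ univ)) :=
    (hcont.mono (prod_mono Ioo_subset_Ico_self Subset.rfl)).aestronglyMeasurable
      (measurableSet_Ioo.prod MeasurableSet.univ)
  have hslc : ∀ τ ∈ Ico 0 T, Continuous (u τ) := fun τ hτ =>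
    (hsol.contDiff_velocity hτ).continuous
  have hsl : ∀ τ ∈ Ico 0 T, AEStronglyMeasurable (u τ) volume := fun τ hτ =>
    (hslc τ hτ).aestronglyMeasurable
  have hdiv0 : IsWeaklyDivFree (u 0) := hLH.isWeaklyDivFree_datum hT
  have hu02 : MemLp (u 0) 2 volume := hLH.memLp 0 ⟨le_rfl, hT.le⟩
  have hmildT : IsMildNSSolutionOn (Ioc 0 T) ν 0 (u 0) u :=
    isMildNSSolutionOn_of_isLerayHopfOn_holds hν hT hu02 hLH
  -- the representation from time `0`, a.e., at every `t ∈ (0, T)`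
  have hrepr : ∀ τ ∈ Ioo 0 T, u τ =ᵐ[volume] fun y =>
      UnboundedOperators.heatExtension (u 0) (ν * τ) y - oseenDuhamel ν 0 u u τ y := by
    intro τ hτ
    set T' : ℝ := (τ + T) / 2 with hT'
    have hT'0 : 0 < T' := by rw [hT']; linarith [hτ.1]
    have hτT' : τ < T' := by rw [hT']; linarith [hτ.2]
    have hT'T : T' < T := by rw [hT']; linarith [hτ.2]
    obtain ⟨M, hM⟩ := hbdd T' ⟨hT'0, hT'T⟩
    have hM' : ∀ σ ∈ Icc 0 T', ∀ y, ‖u σ y‖ ≤ max M 1 := fun σ hσ y =>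
      (hM σ hσ y).trans (le_max_left _ _)
    exact ae_eq_heatExtension_sub_oseenDuhamel_of_isMildNSSolutionOn hν hT'0
      (hmildT.mono (Ioc_subset_Ioc_right hT'T.le))
      (hmeasT.mono_measure (Measure.restrict_mono (prod_mono (Ioo_subset_Ioo_right hT'T.le)
        Subset.rfl) le_rfl))
      (fun σ hσ => hsl σ ⟨hσ.1, hσ.2.trans_lt hT'T⟩) (lt_of_lt_of_le one_pos (le_max_right _ _))
      hM' hdiv0 (fun σ hσ => hLH.memLp σ ⟨hσ.1, hσ.2.trans hT'T.le⟩) ⟨hτ.1, hτT'.le⟩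
  -- uniform essential bounds on sub-strips
  have hbounds : ∀ T₁ ∈ Ioo 0 T, ∃ C : ℝ≥0∞, C < ∞ ∧ ∀ τ ∈ Ico 0 T₁, eLpNorm (u τ) ∞ volume ≤ C := by
    intro T₁ hT₁
    obtain ⟨M, hM⟩ := hbdd T₁ hT₁
    refine ⟨ENNReal.ofReal M, ENNReal.ofReal_lt_top, fun τ hτ => ?_⟩
    rw [eLpNorm_exponent_top]
    exact eLpNormEssSup_le_of_ae_bound (Eventually.of_forall fun y => hM τ ⟨hτ.1, hτ.2.le⟩ y)
  -- restart at `s`, a.e.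
  have hae : u t =ᵐ[volume] fun y =>
      UnboundedOperators.heatExtension (u s) (ν * (t - s)) y - oseenDuhamel ν s u u t y :=
    oseenMild_restart_holds (EuclideanSpace ℝ (Fin 3)) hν hT hmeasT (hsl 0 ⟨le_rfl, hT⟩) hbounds
      hrepr hs hst htT
  -- both sides are continuous in `x`
  obtain ⟨M, hM⟩ := hbdd ((t + T) / 2) ⟨by linarith, by linarith⟩
  have hM0 : 0 ≤ M := (norm_nonneg _).trans (hM 0 ⟨le_rfl, by linarith⟩ 0)
  have hsI : s ∈ Ico 0 T := ⟨hs.le, hst.trans htT⟩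
  have hheat : Continuous fun y => UnboundedOperators.heatExtension (u s) (ν * (t - s)) y :=
    (UnboundedOperators.contDiff_heatExtension_of_bound (m := 0) (hslc s hsI)
      (fun z => hM s ⟨hs.le, by linarith⟩ z) (mul_pos hν (sub_pos.2 hst))).continuous
  have hmeas_st : AEStronglyMeasurable (uncurry u)
      ((volume : Measure (ℝ × EuclideanSpace ℝ (Fin 3))).restrict (Ioo s t ×ˢ univ)) :=
    hmeasT.mono_measure (Measure.restrict_mono
      (prod_mono (Ioo_subset_Ioo hs.le htT.le) Subset.rfl) le_rfl)
  have hbd_st : ∀ τ ∈ Ioo s t, ∀ y, ‖u τ y‖ ≤ M := fun τ hτ y =>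
    hM τ ⟨(hs.trans hτ.1).le, by linarith [hτ.2]⟩ y
  have hduh : Continuous (oseenDuhamel ν s u u t) :=
    continuous_oseenDuhamel_slice hν hM0 hmeas_st hmeas_st hbd_st hbd_st hst le_rfl
  have heq := (Continuous.ae_eq_iff_eq volume (hslc t ⟨hs.le.trans hst.le, htT⟩)
    (hheat.sub hduh)).1 hae
  exact congrFun heq x

/-- **The Oseen equation at unit viscosity for the normalised field** `ũ = timeRescale ν⁻¹ ν⁻¹ u`,
`ũ(s, x) = ν⁻¹u(s/ν, x)`: for `0 < σ < τ < νT`,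
`ũ(τ) = e^{(τ−σ)Δ}ũ(σ) − B¹_σ(ũ, ũ)(τ)` pointwise (KNSS 2009, §1 (1.1): `ν = 1` by rescaling;
Tao 2011, footnote 3). [cite: KochNadirashviliSereginSverak2009, §1 (1.1) (arXiv p. 2)] -/
theorem oseen_eq_timeRescale_of_classical (hν : 0 < ν) (hT : 0 < T)
    (hsol : IsClassicalNSSolutionOn (Ico 0 T) ν 0 u p) (hLH : IsLerayHopfOn T ν 0 (u 0) u)
    (h₀ : HasRapidSpatialDecay (u 0)) {σ τ : ℝ} (hσ : 0 < σ) (hστ : σ < τ) (hτ : τ < ν * T)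
    (x : EuclideanSpace ℝ (Fin 3)) :
    timeRescale ν⁻¹ ν⁻¹ u τ x =
      UnboundedOperators.heatExtension (timeRescale ν⁻¹ ν⁻¹ u σ) (τ - σ) x -
        oseenDuhamel 1 σ (timeRescale ν⁻¹ ν⁻¹ u) (timeRescale ν⁻¹ ν⁻¹ u) τ x := by
  have hν0 : ν ≠ 0 := hν.ne'
  obtain ⟨s, rfl⟩ : ∃ s, σ = ν * s := ⟨ν⁻¹ * σ, by field_simp⟩
  obtain ⟨t, rfl⟩ : ∃ t, τ = ν * t := ⟨ν⁻¹ * τ, by field_simp⟩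
  have hs : 0 < s := by
    rcases lt_or_ge 0 s with h | h
    · exact h
    · nlinarith
  have hst : s < t := lt_of_mul_lt_mul_left hστ hν.le
  have htT : t < T := lt_of_mul_lt_mul_left hτ hν.le
  rw [oseenDuhamel_one_timeRescale hν u hst.le x, timeRescale_apply, timeRescale_slice,
    UnboundedOperators.heatExtension_const_smul, show ν⁻¹ * (ν * t) = t by field_simp,
    show ν⁻¹ * (ν * s) = s by field_simp, show ν * t - ν * s = ν * (t - s) by ring, ← smul_sub,
    oseen_eq_of_classical hν hT hsol hLH h₀ hs hst htT x]

end Oseen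

/-! ### The viscosity-normalising zooms about a final-time point -/

section Zoom

variable {ν T : ℝ} {u : ℝ → EuclideanSpace ℝ (Fin 3) → EuclideanSpace ℝ (Fin 3)}
  {p : ℝ → EuclideanSpace ℝ (Fin 3) → ℝ} {x₀ : EuclideanSpace ℝ (Fin 3)} {C δ R α β c : ℝ}

/-- Window bookkeeping: for `0 < c`, `0 < β`, `δ ≤ T` and `-δ/(c²β) < s < 0` the physical time
`T + c²β s` lies in `(T − δ, T) ⊆ [0, T)`. [folklore] -/
theorem zoom_time_mem (hc : 0 < c) (hβ : 0 < β) (hδT : δ ≤ T) {s : ℝ}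
    (hs : s ∈ Ioo (-(δ / (c ^ 2 * β))) 0) :
    T + c ^ 2 * β * s ∈ Ioo (T - δ) T ∧ T + c ^ 2 * β * s ∈ Ico 0 T := by
  have hcb : 0 < c ^ 2 * β := by positivity
  have h1 : -δ < c ^ 2 * β * s := by
    have := mul_lt_mul_of_pos_left hs.1 hcb
    rwa [mul_neg, mul_div_cancel₀ _ hcb.ne'] at this
  have h2 : c ^ 2 * β * s < 0 := mul_neg_of_pos_of_neg hcb hs.2
  exact ⟨⟨by linarith, by linarith⟩, ⟨by linarith, by linarith⟩⟩

/-- **The zoom is a classical unit-viscosity solution on its final window.** For a classical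
solution `(u, p)` with viscosity `ν > 0` on `[0, T)` and scales `0 < R`, `α = R/ν`, `β = R²/ν`,
`0 < c`, `δ ≤ T`, the pair `w = (cα) • u ∘ Φ`, `q = (cα)² • p ∘ Φ`,
`Φ(s, y) = (T + c²β s, x₀ + cR y)`, is a classical solution of the unforced unit-viscosity system
on the window `(−δ/(c²β), 0)` (Leray's similarity transformation,
`IsClassicalNSSolutionOn.stRescale`). [cite: Leray1934, §20] -/
theorem zoom_isClassical (hν : 0 < ν) (hsol : IsClassicalNSSolutionOn (Ico 0 T) ν 0 u p)
    (hR : 0 < R) (hα : α = R / ν) (hβ : β = R ^ 2 / ν) (hc : 0 < c) (hδT : δ ≤ T) :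
    IsClassicalNSSolutionOn (Ioo (-(δ / (c ^ 2 * β))) 0) 1 0
      ((c * α) • stPull (c ^ 2 * β) (c * R) T x₀ u)
      ((c * α) ^ 2 • stPull (c ^ 2 * β) (c * R) T x₀ p) := by
  have hαpos : 0 < α := by rw [hα]; positivity
  have hβpos : 0 < β := by rw [hβ]; positivity
  have hβ' : c ^ 2 * β = (c * α) * (c * R) := by rw [hβ, hα]; field_simp
  have key := hsol.stRescale (mul_pos hc hαpos) (mul_pos hc hR) hβ' T x₀
  have hvisc : c * α * ν / (c * R) = 1 := by
    rw [hα]; field_simp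
  have hforce : (((c * α) ^ 2 * (c * R)) • stPull (c ^ 2 * β) (c * R) T x₀
      (0 : ℝ → EuclideanSpace ℝ (Fin 3) → EuclideanSpace ℝ (Fin 3))) = 0 := by
    funext s y; simp [stPull]
  rw [hvisc, hforce] at key
  refine key.mono (fun s hs => ?_) isOpen_Ioo.uniqueDiffOn
  exact (zoom_time_mem (T := T) hc hβpos hδT hs).2

/-- The zoom is jointly continuous on its final window. [folklore] -/
theorem zoom_continuousOn (hν : 0 < ν) (hsol : IsClassicalNSSolutionOn (Ico 0 T) ν 0 u p)
    (hR : 0 < R) (hα : α = R / ν) (hβ : β = R ^ 2 / ν) (hc : 0 < c) (hδT : δ ≤ T) :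
    ContinuousOn (uncurry ((c * α) • stPull (c ^ 2 * β) (c * R) T x₀ u))
      (Ioo (-(δ / (c ^ 2 * β))) 0 ×ˢ univ) :=
  (zoom_isClassical (x₀ := x₀) hν hsol hR hα hβ hc hδT).smooth_velocity.continuousOn

/-- The slices of the zoom on its final window are weakly divergence free (they are `C¹` and
divergence free). [folklore] -/
theorem zoom_isWeaklyDivFree (hν : 0 < ν) (hsol : IsClassicalNSSolutionOn (Ico 0 T) ν 0 u p)
    (hR : 0 < R) (hα : α = R / ν) (hβ : β = R ^ 2 / ν) (hc : 0 < c) (hδT : δ ≤ T) {s : ℝ}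
    (hs : s ∈ Ioo (-(δ / (c ^ 2 * β))) 0) :
    IsWeaklyDivFree (((c * α) • stPull (c ^ 2 * β) (c * R) T x₀ u) s) := by
  have h := zoom_isClassical (x₀ := x₀) hν hsol hR hα hβ hc hδT
  exact VectorCalculus.IsDivFree.isWeaklyDivFree_holds (h.divFree s hs)
    ((h.contDiff_velocity hs).of_le (by exact_mod_cast le_top))

/-- **The common Type-I bound of the zooms**: if `√(T − t)‖u(t, x)‖ ≤ C` on the window
`(T − δ, T)`, then on `(−δ/(c²β), 0)` the zoom obeys `‖w(s, y)‖ ≤ (αC/√β)/√(−s)`, a bound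
independent of `c` (the rate is scale invariant; KNSS 2009, (1.4)). [cite: KochNadirashviliSereginSverak2009, (1.4) (arXiv p. 2)] -/
theorem zoom_norm_le (hR : 0 < R) (hα : α = R / ν) (hβ : β = R ^ 2 / ν) (hν : 0 < ν)
    (hc : 0 < c) (hδT : δ ≤ T)
    (hrate : ∀ t ∈ Ioo (T - δ) T, ∀ x, Real.sqrt (T - t) * ‖u t x‖ ≤ C) {s : ℝ}
    (hs : s ∈ Ioo (-(δ / (c ^ 2 * β))) 0) (y : EuclideanSpace ℝ (Fin 3)) :
    ‖((c * α) • stPull (c ^ 2 * β) (c * R) T x₀ u) s y‖ ≤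
      (α * C / Real.sqrt β) / Real.sqrt (-s) := by
  have hαpos : 0 < α := by rw [hα]; positivity
  have hβpos : 0 < β := by rw [hβ]; positivity
  obtain ⟨htw, -⟩ := zoom_time_mem (T := T) hc hβpos hδT hs
  set t : ℝ := T + c ^ 2 * β * s with ht
  have hTt : T - t = c ^ 2 * β * (-s) := by rw [ht]; ring
  have hspos : 0 < -s := neg_pos.2 hs.2
  have hsq : Real.sqrt (T - t) = c * Real.sqrt β * Real.sqrt (-s) := by
    rw [hTt, Real.sqrt_mul (by positivity), Real.sqrt_mul (by positivity), Real.sqrt_sq hc.le]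
  have hsqpos : 0 < Real.sqrt (T - t) := Real.sqrt_pos.2 (sub_pos.2 htw.2)
  have hu : ‖u t (x₀ + (c * R) • y)‖ ≤ C / Real.sqrt (T - t) := by
    rw [le_div_iff₀ hsqpos, mul_comm]; exact hrate t htw _
  have hC : 0 ≤ C := le_trans (mul_nonneg (Real.sqrt_nonneg _) (norm_nonneg _)) (hrate t htw x₀)
  rw [smul_stPull_apply, norm_smul, Real.norm_eq_abs, abs_of_pos (mul_pos hc hαpos)]
  calc c * α * ‖u (T + c ^ 2 * β * s) (x₀ + (c * R) • y)‖
      ≤ c * α * (C / Real.sqrt (T - t)) := mul_le_mul_of_nonneg_left hu (by positivity)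
    _ = (α * C / Real.sqrt β) / Real.sqrt (-s) := by
        rw [hsq]
        field_simp

/-- **The zoom in terms of the viscosity-normalised field**: with `ũ = timeRescale ν⁻¹ ν⁻¹ u`,
`(cα) • u ∘ Φ = (cR) • stPull ((cR)²) (cR) (νT) x₀ ũ` (`α = R/ν`, `β = R²/ν`). [folklore] -/
theorem zoom_eq_smul_stPull_timeRescale (hν : 0 < ν) (hα : α = R / ν) (hβ : β = R ^ 2 / ν) :
    ((c * α) • stPull (c ^ 2 * β) (c * R) T x₀ u) =
      (c * R) • stPull ((c * R) ^ 2) (c * R) (ν * T) x₀ (timeRescale ν⁻¹ ν⁻¹ u) := by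
  have hν0 : ν ≠ 0 := hν.ne'
  funext s y
  rw [smul_stPull_apply, smul_stPull_apply, timeRescale_apply, smul_smul]
  congr 1
  · rw [hα]; field_simp
  · congr 1
    rw [hβ]; field_simp

/-- **The Oseen integral equation of the zooms on their final windows** (KNSS 2009, §1 (1.2)
and proof of Thm. 6.2, p. 13: the rescaled solutions "are mild solutions … for suitable
re-scalings of the initial datum"): for `−δ/(c²β) < σ < τ < 0`,
`w(τ) = e^{(τ−σ)Δ}w(σ) − B¹_σ(w, w)(τ)` pointwise, transported from
`oseen_eq_timeRescale_of_classical` by `oseen_smul_stPull`. [cite: KochNadirashviliSereginSverak2009, §1 (1.2) and proof of Thm 6.2 (arXiv p. 13)] -/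
theorem zoom_oseen (hν : 0 < ν) (hT : 0 < T) (hsol : IsClassicalNSSolutionOn (Ico 0 T) ν 0 u p)
    (hLH : IsLerayHopfOn T ν 0 (u 0) u) (h₀ : HasRapidSpatialDecay (u 0))
    (hR : 0 < R) (hα : α = R / ν) (hβ : β = R ^ 2 / ν) (hc : 0 < c) (hδT : δ ≤ T) {σ τ : ℝ}
    (hσ : -(δ / (c ^ 2 * β)) < σ) (hστ : σ < τ) (hτ : τ < 0) (y : EuclideanSpace ℝ (Fin 3)) :
    ((c * α) • stPull (c ^ 2 * β) (c * R) T x₀ u) τ y =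
      UnboundedOperators.heatExtension (((c * α) • stPull (c ^ 2 * β) (c * R) T x₀ u) σ) (τ - σ) y -
        oseenDuhamel 1 σ ((c * α) • stPull (c ^ 2 * β) (c * R) T x₀ u)
          ((c * α) • stPull (c ^ 2 * β) (c * R) T x₀ u) τ y := by
  have hν0 : ν ≠ 0 := hν.ne'
  have hβpos : 0 < β := by rw [hβ]; positivity
  have hcR : 0 < c * R := mul_pos hc hR
  -- the physical times of `σ` and `τ` at unit viscosity
  have hcb : (c * R) ^ 2 = ν * (c ^ 2 * β) := by rw [hβ]; field_simp
  have hσ' : 0 < ν * T + (c * R) ^ 2 * σ := by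
    have hσs : σ ∈ Ioo (-(δ / (c ^ 2 * β))) 0 := ⟨hσ, hστ.trans hτ⟩
    obtain ⟨-, hI⟩ := zoom_time_mem (T := T) hc hβpos hδT hσs
    have h1 : 0 ≤ T + c ^ 2 * β * σ := hI.1
    have h2 : -δ < c ^ 2 * β * σ := by
      have hcb' : 0 < c ^ 2 * β := by positivity
      have := mul_lt_mul_of_pos_left hσ hcb'
      rwa [mul_neg, mul_div_cancel₀ _ hcb'.ne'] at this
    rw [hcb, show ν * T + ν * (c ^ 2 * β) * σ = ν * (T + c ^ 2 * β * σ) by ring]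
    refine mul_pos hν (lt_of_le_of_ne h1 fun h => ?_)
    -- `T + c²βσ = 0` would force `δ = T` and `σ` at the window entrance, excluded by `hσ`
    have : c ^ 2 * β * σ = -T := by linarith
    linarith
  have hτ' : ν * T + (c * R) ^ 2 * τ < ν * T := by
    have : (c * R) ^ 2 * τ < 0 := mul_neg_of_pos_of_neg (by positivity) hτ
    linarith
  have hστ' : ν * T + (c * R) ^ 2 * σ < ν * T + (c * R) ^ 2 * τ := by
    have := mul_lt_mul_of_pos_left hστ (show 0 < (c * R) ^ 2 by positivity)
    linarith
  rw [zoom_eq_smul_stPull_timeRescale (T := T) (x₀ := x₀) (u := u) (c := c) hν hα hβ]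
  exact oseen_smul_stPull hcR (ν * T) x₀ hστ (fun X =>
    oseen_eq_timeRescale_of_classical hν hT hsol hLH h₀ hσ' hστ' hτ' X) y

/-- **The Morrey bound of the zoomed slices** (scale invariance of `r⁻¹ ∫_{B_r} |u|²`): if
`∫_{B(x₁, ρ)} |u(t)|² ≤ M₀ ρ` for `t ∈ (T₁, T)`, all `x₁` and `0 < ρ ≤ r₀`, then at every time `s`
of the zoom with `T + c²β s ∈ (T₁, T)` and every radius `r` with `cR r ≤ r₀`,
`r⁻¹ ∫_{B(y₁, r)} |w(s)|² ≤ α² M₀ / R²` (the substitution `x = x₀ + cR y`).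
[cite: SereginSverak2009, §3 (definition of A, arXiv p. 9)] -/
theorem zoom_scaledEnergy_le (hR : 0 < R) (hc : 0 < c) {M₀ r₀ T₁ : ℝ}
    (hMor : ∀ t ∈ Ioo T₁ T, ∀ (x₁ : EuclideanSpace ℝ (Fin 3)) (ρ : ℝ), 0 < ρ → ρ ≤ r₀ →
      ∫ x in ball x₁ ρ, ‖u t x‖ ^ 2 ≤ M₀ * ρ)
    {s : ℝ} (hs : T + c ^ 2 * β * s ∈ Ioo T₁ T) (y₁ : EuclideanSpace ℝ (Fin 3)) {r : ℝ} (hr : 0 < r)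
    (hrr₀ : c * R * r ≤ r₀) :
    r⁻¹ * ∫ y in ball y₁ r, ‖((c * α) • stPull (c ^ 2 * β) (c * R) T x₀ u) s y‖ ^ 2 ≤
      α ^ 2 * M₀ / R ^ 2 := by
  have hγpos : 0 < c * R := mul_pos hc hR
  set t : ℝ := T + c ^ 2 * β * s with ht
  set F : EuclideanSpace ℝ (Fin 3) → ℝ := fun x => ‖u t x‖ ^ 2 with hF
  set S : Set (EuclideanSpace ℝ (Fin 3)) := ball (x₀ + (c * R) • y₁) ((c * R) * r) with hSdef
  set A : EuclideanSpace ℝ (Fin 3) → EuclideanSpace ℝ (Fin 3) := fun y => x₀ + (c * R) • y with hA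
  -- the substitution `x = x₀ + (cR) y`
  have hpre : A ⁻¹' S = ball y₁ r := by
    rw [hSdef, hA, space_affine_preimage_ball hγpos, add_sub_cancel_left, smul_smul,
      inv_mul_cancel₀ hγpos.ne', one_smul, mul_div_cancel_left₀ _ hγpos.ne']
  have hind : (fun y => (A ⁻¹' S).indicator (F ∘ A) y) = fun y => S.indicator F (A y) := by
    funext y; exact indicator_comp_right A
  have hsub : ∫ y in ball y₁ r, F (A y) = ((c * R) ^ 3)⁻¹ * ∫ x in S, F x := by
    calc ∫ y in ball y₁ r, F (A y)
        = ∫ y, (A ⁻¹' S).indicator (F ∘ A) y := by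
          rw [← hpre, integral_indicator (measurableSet_ball.preimage (by fun_prop))]
          rfl
      _ = ∫ y, S.indicator F (A y) := by rw [hind]
      _ = ((c * R) ^ 3)⁻¹ * ∫ x in S, F x := by
          rw [hA, integral_comp_space_affine hγpos x₀ (S.indicator F), finrank_euclideanSpace_fin,
            integral_indicator measurableSet_ball, smul_eq_mul]
  -- the slice integrand of the zoom
  have hslice : ∀ y, ‖((c * α) • stPull (c ^ 2 * β) (c * R) T x₀ u) s y‖ ^ 2 =
      (c * α) ^ 2 * F (A y) := by
    intro y
    rw [smul_stPull_apply, norm_smul, mul_pow, Real.norm_eq_abs, sq_abs]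
  have hint_eq : ∫ y in ball y₁ r, ‖((c * α) • stPull (c ^ 2 * β) (c * R) T x₀ u) s y‖ ^ 2 =
      (c * α) ^ 2 * (((c * R) ^ 3)⁻¹ * ∫ x in S, F x) := by
    rw [← hsub, ← integral_const_mul]
    exact integral_congr_ae (Eventually.of_forall fun y => hslice y)
  rw [hint_eq]
  -- the Morrey bound on the physical ball
  have hphys : ∫ x in S, F x ≤ M₀ * ((c * R) * r) :=
    hMor t hs (x₀ + (c * R) • y₁) ((c * R) * r) (by positivity) hrr₀
  have hkey : (c * α) ^ 2 * (((c * R) ^ 3)⁻¹ * ∫ x in S, F x) ≤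
      (c * α) ^ 2 * (((c * R) ^ 3)⁻¹ * (M₀ * ((c * R) * r))) :=
    mul_le_mul_of_nonneg_left (mul_le_mul_of_nonneg_left hphys (by positivity)) (by positivity)
  calc r⁻¹ * ((c * α) ^ 2 * (((c * R) ^ 3)⁻¹ * ∫ x in S, F x))
      ≤ r⁻¹ * ((c * α) ^ 2 * (((c * R) ^ 3)⁻¹ * (M₀ * ((c * R) * r)))) :=
        mul_le_mul_of_nonneg_left hkey (by positivity)
    _ = α ^ 2 * M₀ / R ^ 2 := by
        field_simp

end Zoom




end Summit.NavierStokesRegularity.NavierStokesRegularity.Theorems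

end
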